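import Literature.Probability.FitznerVanDerHofstad2017.SrwTaylorRemainderScaled
import HarnessLib

/-!
# The scaled large-`d` enclosure of the SRW inputs: fully explicit (anchor-free) kernel form

CITATION HEADER. This module is part of a certified REPRODUCTION of:
  R. Fitzner, R. van der Hofstad, *Generalized approach to the non-backtracking lace expansion*,
  PTRF **169** (2017) 1041–1119 [NoBLE17], §5 ((5.1) p. 1090: the SRW inputs `I_{n,l}(x)`), and of
  M. Heydenreich, R. van der Hofstad, *Progress in high-dimensional percolation and random graphs*
  (2017), Prop. 5.5 ((5.4.1)–(5.4.2), `l = 0`: `∫ Ĉⁿ ≤ 2^{6n+2} (2π)^d` for `d ≥ 2n+1`).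

`SrwTaylorRemainderScaled.lean` bounds the Taylor remainder of `I_{n+1,l}(x; d)` by
`Σ_t C(R+t,t) √((2M-1)‼/(2d)^M) √(I^{(D₀)}_{2(n+1-t),0}(0))` with numerical ANCHORS
`I^{(D₀)}_{2j,0}(0)`. Here the anchors are replaced by the tree's kernel bound
`I^{(d)}_{n,0}(0) ≤ 2^{6n+2}` (`HvdH2017Prop55.lintegral_Chat_pow_le`), giving a remainder in which
EVERY constant is an explicit closed form:

* `srwI_zero_zero_le_two_pow` — `I^{(d)}_{n,0}(0) ≤ 2^{6n+2}` for `d ≥ 2n+1` (real form);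
* **`abs_srwI_sub_taylor_le_kernel`** — for `4(n+1)+1 ≤ d` and `M = l+R+1` even,
  `|I^{(d)}_{n+1,l}(x) - Σ_{i ≤ R} C(i+n,n) p^{(d)}_{l+i}(x)|
     ≤ Σ_{t ≤ n} C(R+t,t) · √((2M-1)‼/(2d)^M) · 2^{6(n+1-t)+1}`.

With this, an interval evaluation of the NoBLE chain over a box of dimensions `[D, D']` may take
its SRW inputs as (exact walk-count polynomials in `1/d`) `±` (this bound), with no certified-numerics
input at all on the SRW side. No hypothesis of any theorem here is a programme-internal claim.

## References
* [NoBLE17] R. Fitzner, R. van der Hofstad, PTRF 169 (2017) 1041–1119: (5.1) p. 1090; §2.5 p. 1062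
  (bib key `FitznerVanDerHofstad2016NoBLE`).
* [HvdH17] M. Heydenreich, R. van der Hofstad, *Progress in high-dimensional percolation and random
  graphs*, CRM Short Courses, Springer 2017, Prop. 5.5 (bib key `HeydenreichVanDerHofstad2017`).
-/

noncomputable section

open MeasureTheory Real Finset Filter Topology
open scoped BigOperators Nat

namespace Literature.Probability.FitznerVanDerHofstad2017

open Literature.Barriers.CriticalPhenomena
open Literature.Barriers.CriticalPhenomena.Slade2006Prop53 (P μI)
open Literature.Barriers.CriticalPhenomena.LongRangePhi4 (srwLaw srwLaw_nonneg)

variable {d : ℕ}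

/-- `I^{(d)}_{n,0}(0) = (2π)^{-d} ∫ Ĉⁿ ≤ 2^{6n+2}` for `d ≥ 2n+1` — the real-valued form of the
tree's `HvdH2017Prop55.lintegral_Chat_pow_le`.
[cite: HeydenreichVanDerHofstad2017, Prop. 5.5 ((5.4.1)–(5.4.2), l = 0)] -/
theorem srwI_zero_zero_le_two_pow {n : ℕ} (hd : 2 * n + 1 ≤ d) :
    srwI d n 0 0 ≤ (2 : ℝ) ^ (6 * n + 2) := by
  have hπ := two_pi_pow_pos d
  have e : srwI d n 0 0 = (∫ k, Chat d 1 k ^ n ∂P d) / (2 * π) ^ d := by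
    simp only [srwI, DhatSym_zero, mul_one, pow_zero, one_mul]
  have hnn : 0 ≤ᵐ[P d] fun k => Chat d 1 k ^ n :=
    ae_of_all _ fun k => pow_nonneg (Chat_one_nonneg k) n
  have hint : ∫ k, Chat d 1 k ^ n ∂P d ≤ (2 * π) ^ d * 2 ^ (6 * n + 2) := by
    rw [integral_eq_lintegral_of_nonneg_ae hnn
      (integrable_Chat_pow n hd zero_le_one le_rfl).aestronglyMeasurable]
    exact ENNReal.toReal_le_of_le_ofReal (by positivity)
      (HvdH2017Prop55.lintegral_Chat_pow_le n hd zero_le_one le_rfl)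
  rw [e, div_le_iff₀ hπ]
  linarith [hint]

/-- **Anchor-free scaled enclosure of the SRW inputs.** For `4(n+1)+1 ≤ d` and `M = l+R+1` even,
`|I^{(d)}_{n+1,l}(x) - Σ_{i ≤ R} C(i+n,n) p^{(d)}_{l+i}(x)| ≤
Σ_{t ≤ n} C(R+t,t) √((2M-1)‼/(2d)^M) 2^{6(n+1-t)+1}` — every constant explicit
(Taylor form, `|I_{j,M}(x)| ≤ I_{j,M}(0)`, Cauchy–Schwarz on the torus, Gaussian domination of
`p_{2M}(0;d)`, and `I_{2j,0}(0;d) ≤ 2^{12j+2}`).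
[cite: FitznerVanDerHofstad2016NoBLE, (5.1) p. 1090 and §2.5 p. 1062] -/
theorem abs_srwI_sub_taylor_le_kernel {d n l R : ℕ} (hd : 4 * (n + 1) + 1 ≤ d)
    (he : Even (l + R + 1)) (x : Fin d → ℤ) :
    |srwI d (n + 1) l x - ∑ i ∈ range (R + 1), (((i + n).choose n : ℕ) : ℝ) * srwLaw d (l + i) x|
      ≤ ∑ t ∈ range (n + 1), (((R + t).choose t : ℕ) : ℝ) *
          (Real.sqrt ((((2 * (l + R + 1) - 1)‼ : ℕ) : ℝ) / (2 * (d : ℝ)) ^ (l + R + 1)) *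
            (2 : ℝ) ^ (6 * (n + 1 - t) + 1)) := by
  have hA : ∀ j : ℕ, 4 * j + 1 ≤ d → Real.sqrt (srwI d (2 * j) 0 0) ≤ (2 : ℝ) ^ (6 * j + 1) := by
    intro j hj
    have h := srwI_zero_zero_le_two_pow (d := d) (n := 2 * j) (by omega)
    calc Real.sqrt (srwI d (2 * j) 0 0) ≤ Real.sqrt ((2 : ℝ) ^ (6 * (2 * j) + 2)) :=
          Real.sqrt_le_sqrt h
      _ = (2 : ℝ) ^ (6 * j + 1) := by
          rw [show (2 : ℝ) ^ (6 * (2 * j) + 2) = ((2 : ℝ) ^ (6 * j + 1)) ^ 2 by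
            rw [← pow_mul]; congr 1; ring]
          exact Real.sqrt_sq (by positivity)
  refine (abs_srwI_sub_taylor_le_scaled (D₀ := d) hd le_rfl he x).trans
    (sum_le_sum fun t ht => ?_)
  rw [mem_range] at ht
  refine mul_le_mul_of_nonneg_left ?_ (Nat.cast_nonneg _)
  exact mul_le_mul_of_nonneg_left (hA (n + 1 - t) (by omega)) (Real.sqrt_nonneg _)

end Literature.Probability.FitznerVanDerHofstad2017

end
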